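import Summits.BirchSwinnertonDyer.BirchSwinnertonDyer.Theorems.GenusKolyvaginAtTwoGenusDeepSupplyAtTwoNegDiscNarrowOfKernelsMixed
import Summits.BirchSwinnertonDyer.BirchSwinnertonDyer.Theorems.GenusKolyvaginAtTwoGenusPrimitiveSupplyAtTwoPosDiscShallowOfKernelsMixed
import Summits.BirchSwinnertonDyer.BirchSwinnertonDyer.Theorems.GenusKolyvaginAtTwoEquivariantChebotarevAtTwoR
import Summits.BirchSwinnertonDyer.BirchSwinnertonDyer.Theorems.GenusKolyvaginAtTwoEquivariantKolyvaginExactAtTwoRT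
import Summits.BirchSwinnertonDyer.BirchSwinnertonDyer.Theorems.GenusKolyvaginAtTwoKolyvaginExactAtTwoPosDiscT
import Summits.BirchSwinnertonDyer.BirchSwinnertonDyer.Theorems.GenusKolyvaginAtTwoCyclicTorsionOfNegDisc
import Summits.BirchSwinnertonDyer.BirchSwinnertonDyer.Theorems.GenusKolyvaginAtTwoExactDescentAtTwoOfFourFactsClosed
import Summits.BirchSwinnertonDyer.BirchSwinnertonDyer.Theorems.GenusKolyvaginAtTwoShaVanishingAtDepthZeroAtTwo
import Summits.BirchSwinnertonDyer.BirchSwinnertonDyer.Theorems.GenusKolyvaginAtTwoKolyvaginRelationAtTwo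
import HarnessLib

/-!
# Route `GenusKolyvaginAtTwo`, rev 57: THE ROUTE LEDGER — the leaf `NonCMAtTwo` from EXACTLY the open items, every closed item discharged BY NAME

LEAD seat `bsd-line-gk2-p1` g23 (cell `bsd-f1-sign2`), `--supports stmt-BirchSwinnertonDyer-23491 --as helper`.  THEOREMS ONLY (no definition, no
named fact, no `sorry`).  **BSD is NOT proved by this file.  The leaf `Rank1Residual.NonCMAtTwo` is NOT proved: it is derived from SIXTEEN displayed
hypotheses, each of which is an OPEN route item or a PRINT fact.**  The point of the file is the exact list.

`nonCMAtTwo_of_openItems_rev57` = the deciding theorem `closes` (rev 57, eighteen binders) with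
* the two supply cruxes `GenusPrimitiveSupplyAtTwoPosDiscShallow` (25504) / `GenusDeepSupplyAtTwoNegDiscNarrow` (23491) REPLACED by their items through the
  LEAD g22 glue-by theorems p766811 / p766796 (`…PrimeFrame.genus…_of_items_of_selmerSplit_mixed`: GZ → Mod → Par → Conv → Conv′ → K1± → K4± → crux);
* the SIX closed items discharged by their accepted closers: Q1 `CyclicTorsionOfNegDisc` (24879, `GenusCyclicTorsion.cyclicTorsionOfNegDisc_proof`), Q5R
  `EquivariantChebotarevAtTwoR` (27280, `GenusExact.equivariantChebotarevAtTwoR_proof`), Q3R_T `EquivariantKolyvaginExactAtTwoRT` (23468,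
  `equivariantKolyvaginExactAtTwoRT_proof`), Q4_T″ `KolyvaginExactAtTwoPosDiscT` (25502, `kolyvaginExactAtTwoPosDiscT_proof`), `ExactDescentAtTwoOfFourFacts`
  (24238, `GenusExactDescent.exactDescentAtTwoOfFourFacts_proof`), `ShaVanishingAtDepthZeroAtTwo` (31538, `shaVanishingAtDepthZeroAtTwo_proof`, this seat);
* Q2 `KolyvaginRelationAtTwo` (24880) replaced by the PRINT fact `prop37_2_frobeniusCongruence` (item 23091) through gk2-p2 g7's
  `GenusExact.kolyvaginRelationAtTwo_of_frobeniusCongruence`.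

WHAT IS LEFT (the sixteen binders, grouped):
* PRINT / declared (9): `GrossZagierAllLevels` 24148, `ModularityExistsNewform` 19382, `TwoParityDD` 23327, `RankOneTwoConverse` 19220 (the open
  2-converse, declared), `RankOneTwoConverseOffSemistableAtTwo` 24948, `EntireLFunctionRat` 19273, `MultPublishedInputsAtTwo` 19921, `MilneAnyModel` 24149,
  `prop37_2_frobeniusCongruence` (23091).
* BEYOND PRINT, the kernels (4): `K1Neg` 31525, `K1Pos` 31468 (depth zero; LOSSLESS — implied by the leaf modulo print), `K4Neg` 31526, `K4Pos` 31469
  (Kolyvagin's conjecture `𝓜_∞ = 0` at `p = 2` on the `#Sel₂(E) = 4` cells).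
* BEYOND PRINT, other lines (3): `MinimalTwinBSDTwo` 22985 (LINE 23), `OffHabitatResidualAtTwo` 22139 (split: 27467–27471), `OffCutResidualAtTwoR` 31767.
References: [GrossLMS1991] §11; [McCallumLMS1991] §5; [WZhang2014] Thm. 1.1; [Kramer1981] Thm. 1.
-/

set_option linter.dupNamespace false -- `Summit.<P>.<Sub>` repeats `BirchSwinnertonDyer` (D-0017)
set_option autoImplicit false

noncomputable section

namespace Summit.BirchSwinnertonDyer.BirchSwinnertonDyer.Theorems.GenusSupplyNarrow.RouteLedger

open Summit.BirchSwinnertonDyer.BirchSwinnertonDyer.Theses.GenusKolyvaginAtTwo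
open Summit.BirchSwinnertonDyer.BirchSwinnertonDyer.Theorems
open Literature.NumberTheory.EllipticCurves.GrossLMS1991 (prop37_2_frobeniusCongruence)

/-- **THE ROUTE LEDGER AT REV 57**: the leaf `Rank1Residual.NonCMAtTwo` from nine PRINT / declared facts (GZ, Mod, Par, Conv, Conv′, L, GZK, Milne, Gross 3.7 (2)),
the four beyond-print KERNELS (`K1Neg`, `K4Neg`, `K1Pos`, `K4Pos`) and the three other-line items (`MinimalTwinBSDTwo`, `OffHabitatResidualAtTwo`,
`OffCutResidualAtTwoR`) — every other hypothesis of `closes` being an accepted theorem of the tree.  A LEDGER, not a proof of the leaf: all sixteen binders are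
open.  BSD is NOT proved by this. [cite: GrossLMS1991, §11] [cite: WZhang2014, Thm. 1.1] -/
theorem nonCMAtTwo_of_openItems_rev57
    -- PRINT / declared
    (hGZ : GrossZagierAllLevels) (hmod : ModularityExistsNewform) (hpar : TwoParityDD) (hconv : RankOneTwoConverse)
    (hconv' : RankOneTwoConverseOffSemistableAtTwo) (hL : EntireLFunctionRat) (hGZK : MultPublishedInputsAtTwo) (hMi : MilneAnyModel)
    (h37 : prop37_2_frobeniusCongruence)
    -- the kernels
    (hK1N : K1Neg) (hK4N : K4Neg) (hK1P : K1Pos) (hK4P : K4Pos)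
    -- other lines
    (hTw : MinimalTwinBSDTwo) (hR : OffHabitatResidualAtTwo) (hOff : OffCutResidualAtTwoR) :
    Summit.BirchSwinnertonDyer.BirchSwinnertonDyer.Rank1Residual.NonCMAtTwo :=
  closes
    (GenusSupplyPos.PrimeFrame.genusPrimitiveSupplyAtTwoPosDiscShallow_of_items_of_selmerSplit_mixed hGZ hmod hpar hconv hconv' hK1P hK4P)
    (GenusSupplyNarrow.PrimeFrame.genusDeepSupplyAtTwoNegDiscNarrow_of_items_of_selmerSplit_mixed hGZ hmod hpar hconv hconv' hK1N hK4N)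
    GenusCyclicTorsion.cyclicTorsionOfNegDisc_proof
    (GenusExact.kolyvaginRelationAtTwo_of_frobeniusCongruence h37)
    GenusExact.equivariantChebotarevAtTwoR_proof equivariantKolyvaginExactAtTwoRT_proof kolyvaginExactAtTwoPosDiscT_proof
    GenusExactDescent.exactDescentAtTwoOfFourFacts_proof hR hOff hK1P hK1N shaVanishingAtDepthZeroAtTwo_proof hTw hL hGZ hGZK hMi

end Summit.BirchSwinnertonDyer.BirchSwinnertonDyer.Theorems.GenusSupplyNarrow.RouteLedger

end
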